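import Mathlib
import HarnessLib
import Literature.NumberTheory.Sieve.BatemanHorn
import Summits.Parity.BatemanHorn.Theorems.AlmostPrimeZerosSystemZeroRepulsionEulerLemmas

/-!
# The complex Euler-product bound (Λ) (stub `stub_eulerBoundComplex`, Stage B of S4, part 2)

Line `smooth-rough-lattice-acquisition` of crux stmt-Parity-11291
(`Summit.Parity.BatemanHorn.Theses.AlmostPrimeZeros.SystemZeroRepulsion`), stub S4.

With `π_p(b) = Σ_i ([p ∣ f_i(b)] + [p² ∣ f_i(b)])`, `E_p(z) = Σ_{b < p²} z^{π_p(b)}`, granting the local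
factor law (Stage A), for `Y ≥ Y₀(f)` and every `z ∈ ℂ`:
`‖∏_{p ≤ Y} E_p(z)/p²‖ ≤ A (log Y)^{k(Re z − 1)} e^{C ‖z−1‖ log(‖z−1‖+2)}`.
Proof: primes `p ≤ P = max(P₁, r+2)` (`r = ‖z − 1‖`) by the trivial bound `max(1,‖z‖)^{2k}`
(`≤ e^{O(1) + O(r log(r+2))}` in total); primes `p > P` are good, `E_p(z)/p² = 1 + w_p`,
`w_p = ω(z−1)(p+z)/p²`, `|1 + w| ≤ e^{Re w + |w|²/2}`, `Σ_{p > P} 1/p² ≤ 2/P`, and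
`Re(z−1) Σ_{P<p≤Y} ω(p)/p` is `k Re(z−1) log log Y + O(r log(r+2))` by `stub_mertensOmega`.
-/

noncomputable section

namespace Summit.Parity.BatemanHorn.Cruxes.SystemZeroRepulsion.SmoothRoughLatticeAcquisition

open Finset Literature.NumberTheory.Sieve

/-- Large good primes: `‖E_p(z)/p²‖ ≤ exp(ω Re(z−1)/p + (D r (1+r) + 2 D² r²)/p²)` for `r + 2 ≤ p`,
`r = ‖z − 1‖`, `ω ≤ D` (`E_p(z)/p² = 1 + w`, `|1 + w| ≤ e^{Re w + |w|²/2}`). -/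
private theorem locE_large {p ω D : ℕ} (e : ℕ → ℕ) (hωD : ω ≤ D) (z : ℂ)
    (hpr : ‖z - 1‖ + 2 ≤ (p : ℝ))
    (hE : ∑ b ∈ range (p ^ 2), z ^ e b = (p : ℂ) ^ 2 + ω * (z - 1) * (p + z)) :
    ‖(∑ b ∈ range (p ^ 2), z ^ e b) / (p : ℂ) ^ 2‖ ≤
      Real.exp (ω * (z.re - 1) / p +
        (D * ‖z - 1‖ * (1 + ‖z - 1‖) + 2 * (D : ℝ) ^ 2 * ‖z - 1‖ ^ 2) / (p : ℝ) ^ 2) := by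
  set r : ℝ := ‖z - 1‖ with hr
  have hr0 : 0 ≤ r := norm_nonneg _
  have hp0 : (0 : ℝ) < p := by linarith
  have hpC : (p : ℂ) ≠ 0 := by exact_mod_cast hp0.ne'
  set c : ℝ := ω / (p : ℝ) ^ 2 with hc
  set v : ℂ := (z - 1) * (p + z) with hv
  have hc0 : 0 ≤ c := by positivity
  have hcD : c ≤ D / (p : ℝ) ^ 2 := by
    rw [hc]
    exact div_le_div_of_nonneg_right (by exact_mod_cast hωD) (by positivity)
  have hw : (∑ b ∈ range (p ^ 2), z ^ e b) / (p : ℂ) ^ 2 = 1 + (c : ℂ) * v := by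
    rw [hE, hc, hv]
    push_cast
    field_simp
  rw [hw]
  refine (norm_one_add_le_exp _).trans (Real.exp_le_exp.2 ?_)
  -- real part
  have hz : ‖z‖ ≤ 1 + r := by
    have : ‖z‖ ≤ ‖z - 1‖ + ‖(1 : ℂ)‖ := by simpa using norm_add_le (z - 1) (1 : ℂ)
    rw [norm_one] at this
    linarith
  have hvre : v.re ≤ p * (z.re - 1) + r * (1 + r) := by
    have e1 : v.re = p * (z.re - 1) + ((z - 1) * z).re := by
      rw [hv]; simp [Complex.mul_re]; ring
    rw [e1]
    have : ((z - 1) * z).re ≤ r * (1 + r) :=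
      (Complex.re_le_norm _).trans (by rw [norm_mul]; exact mul_le_mul_of_nonneg_left hz hr0)
    linarith
  have hre : ((c : ℂ) * v).re ≤ ω * (z.re - 1) / p + D * r * (1 + r) / (p : ℝ) ^ 2 := by
    rw [Complex.re_ofReal_mul]
    calc c * v.re ≤ c * (p * (z.re - 1) + r * (1 + r)) := mul_le_mul_of_nonneg_left hvre hc0
      _ = ω * (z.re - 1) / p + c * (r * (1 + r)) := by rw [hc]; field_simp
      _ ≤ ω * (z.re - 1) / p + D / (p : ℝ) ^ 2 * (r * (1 + r)) := by
          gcongr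
      _ = _ := by ring
  -- modulus
  have hvn : ‖v‖ ≤ r * (2 * p) := by
    rw [hv, norm_mul]
    refine mul_le_mul_of_nonneg_left ?_ hr0
    calc ‖(p : ℂ) + z‖ ≤ ‖(p : ℂ)‖ + ‖z‖ := norm_add_le _ _
      _ ≤ p + (1 + r) := by rw [Complex.norm_natCast]; linarith
      _ ≤ 2 * p := by linarith
  have hwn : ‖(c : ℂ) * v‖ ≤ 2 * D * r / p := by
    rw [norm_mul, Complex.norm_of_nonneg hc0]
    calc c * ‖v‖ ≤ D / (p : ℝ) ^ 2 * (r * (2 * p)) :=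
          mul_le_mul hcD hvn (norm_nonneg _) (by positivity)
      _ = 2 * D * r / p := by field_simp
  have hwn2 : ‖(c : ℂ) * v‖ ^ 2 / 2 ≤ 2 * (D : ℝ) ^ 2 * r ^ 2 / (p : ℝ) ^ 2 := by
    have h := pow_le_pow_left₀ (norm_nonneg _) hwn 2
    calc ‖(c : ℂ) * v‖ ^ 2 / 2 ≤ (2 * D * r / p) ^ 2 / 2 := by gcongr
      _ = 2 * (D : ℝ) ^ 2 * r ^ 2 / (p : ℝ) ^ 2 := by field_simp
  calc ((c : ℂ) * v).re + ‖(c : ℂ) * v‖ ^ 2 / 2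
      ≤ (ω * (z.re - 1) / p + D * r * (1 + r) / (p : ℝ) ^ 2) + 2 * (D : ℝ) ^ 2 * r ^ 2 / (p : ℝ) ^ 2 :=
        add_le_add hre hwn2
    _ = _ := by ring

/-! ### The Euler-product bounds for abstract local data -/

/-- **(Λ) engine.**  For local patterns `π_p ≤ 2k` whose good-prime factors are
`E_p(z) = p² + ω(p)(z−1)(p+z)` (`p > P₁ ≥ 3`, `ω(p) ≤ D`) and a two-sided Mertens estimate for
`Σ ω(p)/p`, `‖∏_{p ≤ Y} E_p(z)/p²‖ ≤ A (log Y)^{k(Re z−1)} e^{C‖z−1‖ log(‖z−1‖+2)}` for `Y ≥ 3`. -/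
private theorem engine_complex {k D P₁ : ℕ} {K : ℝ} (π : ℕ → ℕ → ℕ) (ω : ℕ → ℕ) (hP₁ : 3 ≤ P₁)
    (hK : 0 ≤ K) (hπk : ∀ p b, π p b ≤ 2 * k)
    (hgood : ∀ p : ℕ, p.Prime → P₁ < p → ω p ≤ D ∧ ∀ z : ℂ,
      ∑ b ∈ range (p ^ 2), z ^ π p b = (p : ℂ) ^ 2 + ω p * (z - 1) * (p + z))
    (hM : ∀ P Y : ℝ, 3 ≤ P → P ≤ Y →
      |(∑ p ∈ (Nat.primesLE ⌊Y⌋₊).filter (fun p : ℕ => P < (p : ℝ)), (ω p : ℝ) / p) -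
        k * (Real.log (Real.log Y) - Real.log (Real.log P))| ≤ K) :
    ∃ A C : ℝ, 0 ≤ A ∧ 0 ≤ C ∧ ∀ Y : ℝ, 3 ≤ Y → ∀ z : ℂ,
      ‖∏ p ∈ Nat.primesLE ⌊Y⌋₊, (∑ b ∈ range (p ^ 2), z ^ π p b) / (p : ℂ) ^ 2‖ ≤
        A * Real.log Y ^ ((k : ℝ) * (z.re - 1)) *
          Real.exp (C * ‖z - 1‖ * Real.log (‖z - 1‖ + 2)) := by
  classical
  have hk0 : (0 : ℝ) ≤ k := Nat.cast_nonneg k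
  have hD0 : (0 : ℝ) ≤ D := Nat.cast_nonneg D
  have hP₁' : (3 : ℝ) ≤ P₁ := by exact_mod_cast hP₁
  have hlogP₁ : 0 ≤ Real.log P₁ := Real.log_nonneg (by linarith)
  set C₁ : ℝ := 2 * k * (P₁ + 3) with hC₁
  set C₂ : ℝ := k * Real.log P₁ + K + 2 * D + 4 * (D : ℝ) ^ 2 with hC₂
  have hC₁0 : 0 ≤ C₁ := by positivity
  have hC₂0 : 0 ≤ C₂ := by positivity
  refine ⟨Real.exp C₁, C₁ + 2 * k + k + 2 * C₂, (Real.exp_pos _).le, by positivity,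
    fun Y hY z => ?_⟩
  rw [norm_prod]
  set r : ℝ := ‖z - 1‖ with hr
  set ρ : ℝ := z.re - 1 with hρ
  set ℓ : ℝ := Real.log (r + 2) with hℓ
  set S := Nat.primesLE ⌊Y⌋₊ with hS
  set P : ℝ := max (P₁ : ℝ) (r + 2) with hP
  set g : ℕ → ℝ := fun p => ‖(∑ b ∈ range (p ^ 2), z ^ π p b) / (p : ℂ) ^ 2‖ with hg
  have hr0 : 0 ≤ r := norm_nonneg _
  have hρr : |ρ| ≤ r := by
    have h := Complex.abs_re_le_norm (z - 1)
    rwa [Complex.sub_re, Complex.one_re] at h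
  have hz : ‖z‖ ≤ 1 + r := by
    have : ‖z‖ ≤ ‖z - 1‖ + ‖(1 : ℂ)‖ := by simpa using norm_add_le (z - 1) (1 : ℂ)
    rw [norm_one] at this
    linarith
  have hℓ0 : 1 / 2 ≤ ℓ :=
    le_trans (by linarith [Real.log_two_gt_d9]) (Real.log_le_log two_pos (by linarith))
  have hrℓ : r ≤ 2 * (r * ℓ) := by
    have := mul_le_mul_of_nonneg_left hℓ0 hr0
    linarith
  have hY1 : 1 < Real.log Y := lt_of_lt_of_le
    Literature.NumberTheory.LFunctions.MertensBound.one_lt_log_three (Real.log_le_log (by norm_num) hY)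
  have hllY : 0 ≤ Real.log (Real.log Y) := Real.log_nonneg hY1.le
  have hP3 : 3 ≤ P := le_trans hP₁' (le_max_left _ _)
  have hPr : r + 2 ≤ P := le_max_right _ _
  have hPle : P ≤ P₁ + r + 2 := max_le (by linarith) (by linarith)
  have hlogP : Real.log P ≤ Real.log P₁ + ℓ := by
    rw [hℓ, ← Real.log_mul (by positivity) (by positivity)]
    refine Real.log_le_log (by positivity) ?_
    have := mul_nonneg hr0 (show (0 : ℝ) ≤ P₁ - 1 by linarith)
    linarith
  have hllP : |Real.log (Real.log P)| ≤ Real.log P := by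
    have h1 : 1 < Real.log P := lt_of_lt_of_le
      Literature.NumberTheory.LFunctions.MertensBound.one_lt_log_three (Real.log_le_log (by norm_num) hP3)
    rw [abs_of_nonneg (Real.log_nonneg h1.le)]
    linarith [Real.log_le_sub_one_of_pos (show 0 < Real.log P by linarith)]
  rw [← prod_filter_mul_prod_filter_not S (fun p : ℕ => P < (p : ℝ))]
  -- (2) large primes `p > P`
  have hlarge : ∏ p ∈ S.filter (fun p : ℕ => P < (p : ℝ)), g p ≤
      Real.exp (k * ρ * Real.log (Real.log Y) + C₂ * r + k * (r * ℓ)) := by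
    set T := S.filter (fun p : ℕ => P < (p : ℝ)) with hT
    have hTgood : ∀ p ∈ T, p.Prime ∧ P₁ < p ∧ r + 2 ≤ (p : ℝ) := by
      intro p hp
      rw [hT, mem_filter, hS, Nat.mem_primesLE] at hp
      refine ⟨hp.1.2, ?_, by linarith⟩
      exact_mod_cast lt_of_le_of_lt (le_max_left _ _) hp.2
    set X : ℝ := D * r * (1 + r) + 2 * (D : ℝ) ^ 2 * r ^ 2 with hX
    have hX0 : 0 ≤ X := by positivity
    have hstep : ∏ p ∈ T, g p ≤ Real.exp (∑ p ∈ T, ((ω p : ℝ) * ρ / p + X / (p : ℝ) ^ 2)) := by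
      refine prod_le_exp_sum T (fun p _ => norm_nonneg _) fun p hp => ?_
      obtain ⟨hpp, hp1, hpr⟩ := hTgood p hp
      obtain ⟨hωD, hE⟩ := hgood p hpp hp1
      exact locE_large (π p) hωD z hpr (hE z)
    refine hstep.trans (Real.exp_le_exp.2 ?_)
    rw [sum_add_distrib]
    have h2 : ∑ p ∈ T, X / (p : ℝ) ^ 2 ≤ 2 * D * r + 4 * (D : ℝ) ^ 2 * r := by
      have hs := sum_inv_sq_filter_le (S := S) (N := ⌊Y⌋₊)
        (fun p hp => (Nat.mem_primesLE.1 hp).1) (show 0 < P by linarith)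
      calc ∑ p ∈ T, X / (p : ℝ) ^ 2 = X * ∑ p ∈ T, 1 / (p : ℝ) ^ 2 := by
            rw [mul_sum]
            exact sum_congr rfl fun p _ => by ring
        _ ≤ X * (2 / P) := mul_le_mul_of_nonneg_left hs hX0
        _ ≤ X * (2 / (r + 2)) := by gcongr
        _ ≤ 2 * D * r + 4 * (D : ℝ) ^ 2 * r := by
            rw [hX, ← mul_div_assoc, div_le_iff₀ (by linarith)]
            linarith [mul_nonneg hD0 hr0, mul_nonneg (mul_nonneg hD0 hD0) hr0]
    have h1 : ∑ p ∈ T, (ω p : ℝ) * ρ / p ≤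
        k * ρ * Real.log (Real.log Y) + (k * Real.log P₁ + K) * r + k * (r * ℓ) := by
      have e : ∑ p ∈ T, (ω p : ℝ) * ρ / p = ρ * ∑ p ∈ T, (ω p : ℝ) / p := by
        rw [mul_sum]
        exact sum_congr rfl fun p _ => by ring
      rw [e]
      by_cases hPY : P ≤ Y
      · have hΩ := hM P Y hP3 hPY
        set Ω := ∑ p ∈ T, (ω p : ℝ) / p with hΩ_def
        have hd : |ρ * (Ω - k * (Real.log (Real.log Y) - Real.log (Real.log P)))| ≤ r * K := by
          rw [abs_mul]
          exact mul_le_mul hρr hΩ (abs_nonneg _) hr0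
        have he : |ρ * (k * Real.log (Real.log P))| ≤ r * (k * Real.log P) := by
          rw [abs_mul, abs_mul, abs_of_nonneg hk0]
          exact mul_le_mul hρr (mul_le_mul_of_nonneg_left hllP hk0) (by positivity) hr0
        have hd' := (abs_le.1 hd).2
        have he' := (abs_le.1 he).1
        have hf : r * (k * Real.log P) ≤ r * (k * (Real.log P₁ + ℓ)) :=
          mul_le_mul_of_nonneg_left (mul_le_mul_of_nonneg_left hlogP hk0) hr0
        have eq : ρ * Ω = k * ρ * Real.log (Real.log Y) - ρ * (k * Real.log (Real.log P)) +
            ρ * (Ω - k * (Real.log (Real.log Y) - Real.log (Real.log P))) := by ring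
        rw [eq]
        linarith
      · have hT0 : T = ∅ := by
          rw [hT]
          refine filter_false_of_mem fun p hp => ?_
          have : (p : ℝ) ≤ Y :=
            le_trans (by exact_mod_cast (Nat.mem_primesLE.1 hp).1) (Nat.floor_le (by linarith))
          push Not at hPY
          linarith
        rw [hT0, sum_empty, mul_zero]
        push Not at hPY
        have hYP : Real.log (Real.log Y) ≤ Real.log P₁ + ℓ :=
          calc Real.log (Real.log Y) ≤ Real.log (Real.log P) :=
                Real.log_le_log (by linarith) (Real.log_le_log (by linarith) hPY.le)
            _ ≤ |Real.log (Real.log P)| := le_abs_self _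
            _ ≤ Real.log P := hllP
            _ ≤ _ := hlogP
        have hρ1 := (abs_le.1 hρr).1
        have h3 : -(k * r * Real.log (Real.log Y)) ≤ k * ρ * Real.log (Real.log Y) := by
          have := mul_le_mul_of_nonneg_left hρ1 (mul_nonneg hk0 hllY)
          linarith
        linarith [mul_le_mul_of_nonneg_left hYP (mul_nonneg hk0 hr0), mul_nonneg hK hr0]
    rw [hC₂]
    linarith [h1, h2]
  -- (1) small primes `p ≤ P`: the trivial bound
  have hsmall : ∏ p ∈ S.filter (fun p : ℕ => ¬P < (p : ℝ)), g p ≤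
      Real.exp (C₁ + (C₁ + 2 * k) * (r * ℓ)) := by
    set T' := S.filter (fun p : ℕ => ¬P < (p : ℝ)) with hT'
    have hcard : (#T' : ℝ) ≤ P + 1 := by
      have hsub : T' ⊆ range (⌊P⌋₊ + 1) := by
        intro p hp
        rw [hT', mem_filter, not_lt] at hp
        exact mem_range.2 (Nat.lt_succ_of_le (Nat.le_floor hp.2))
      have h1 : #T' ≤ ⌊P⌋₊ + 1 := (card_le_card hsub).trans (card_range _).le
      calc (#T' : ℝ) ≤ ⌊P⌋₊ + 1 := by exact_mod_cast h1
        _ ≤ P + 1 := by linarith [Nat.floor_le (show 0 ≤ P by linarith)]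
    have hB : ∀ p ∈ T', g p ≤ (1 + r) ^ (2 * k) := by
      intro p _
      calc g p ≤ (∑ b ∈ range (p ^ 2), ‖z‖ ^ π p b) / (p : ℝ) ^ 2 := by
            rw [hg]
            dsimp only
            rw [norm_div, norm_pow, Complex.norm_natCast]
            exact div_le_div_of_nonneg_right (norm_locE_le _ _ _) (by positivity)
        _ ≤ max 1 ‖z‖ ^ (2 * k) := locE_div_le_trivial (π p) (hπk p) (norm_nonneg z)
        _ ≤ (1 + r) ^ (2 * k) := pow_le_pow_left₀ (by positivity) (max_le (by linarith) hz) _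
    refine (prod_le_pow_card_of_le T' (fun p _ => norm_nonneg _) hB).trans ?_
    rw [← pow_mul, ← Real.exp_log (pow_pos (by linarith : (0 : ℝ) < 1 + r) _), Real.exp_le_exp,
      Real.log_pow]
    have hlog1r : Real.log (1 + r) ≤ ℓ := Real.log_le_log (by linarith) (by linarith)
    have hℓle : ℓ ≤ 1 + r * ℓ := by
      have h1 : ℓ ≤ Real.log 2 + r / 2 := by
        rw [hℓ, show r + 2 = 2 * (1 + r / 2) by ring, Real.log_mul two_ne_zero (by positivity)]
        linarith [Real.log_le_sub_one_of_pos (show 0 < 1 + r / 2 by positivity)]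
      have h2 := mul_le_mul_of_nonneg_left hℓ0 hr0
      linarith [Real.log_two_lt_d9]
    push_cast
    calc (2 * k * #T' : ℝ) * Real.log (1 + r) ≤ (2 * k * (P + 1)) * ℓ :=
          mul_le_mul (by gcongr) hlog1r (Real.log_nonneg (by linarith)) (by positivity)
      _ ≤ 2 * k * (P₁ + r + 3) * ℓ := by
          have : P + 1 ≤ P₁ + r + 3 := by linarith
          exact mul_le_mul_of_nonneg_right (mul_le_mul_of_nonneg_left this (by positivity))
            (by linarith)
      _ = C₁ * ℓ + 2 * k * (r * ℓ) := by rw [hC₁]; ring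
      _ ≤ C₁ * (1 + r * ℓ) + 2 * k * (r * ℓ) := by gcongr
      _ = C₁ + (C₁ + 2 * k) * (r * ℓ) := by ring
  -- combine
  have hexp : Real.log Y ^ ((k : ℝ) * ρ) = Real.exp (k * ρ * Real.log (Real.log Y)) := by
    rw [Real.rpow_def_of_pos (by linarith)]
    congr 1
    ring
  calc (∏ p ∈ S.filter (fun p : ℕ => P < (p : ℝ)), g p) *
        ∏ p ∈ S.filter (fun p : ℕ => ¬P < (p : ℝ)), g p
      ≤ Real.exp (k * ρ * Real.log (Real.log Y) + C₂ * r + k * (r * ℓ)) *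
          Real.exp (C₁ + (C₁ + 2 * k) * (r * ℓ)) :=
        mul_le_mul hlarge hsmall (prod_nonneg fun p _ => norm_nonneg _) (Real.exp_pos _).le
    _ = Real.exp C₁ * Real.exp (k * ρ * Real.log (Real.log Y)) *
          Real.exp (C₂ * r + k * (r * ℓ) + (C₁ + 2 * k) * (r * ℓ)) := by
        rw [← Real.exp_add, ← Real.exp_add, ← Real.exp_add]
        congr 1
        ring
    _ ≤ Real.exp C₁ * Real.exp (k * ρ * Real.log (Real.log Y)) *
          Real.exp ((C₁ + 2 * k + k + 2 * C₂) * r * ℓ) := by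
        gcongr
        linarith [mul_le_mul_of_nonneg_left hrℓ hC₂0]
    _ = _ := by rw [hexp]


/-- **`stub_eulerBoundComplex`** — the Euler-product bound (Λ) from the local factor law (Stage A):
for `Y ≥ Y₀(f)` and all `z`, `‖∏_{p ≤ Y} E_p(z)/p²‖ ≤ A (log Y)^{k(Re z−1)} e^{C‖z−1‖ log(‖z−1‖+2)}`
with `A ≥ 0`. -/
theorem stub_eulerBoundComplex :
    (∀ (k : ℕ) (f : Fin k → Polynomial ℤ), Literature.NumberTheory.Sieve.IsBatemanHornSystem f →
      ∃ P₀ : ℕ, ∀ p : ℕ, p.Prime → P₀ < p →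
        Literature.NumberTheory.Sieve.polyRootCountMod f p ≤ ∑ i, (f i).natDegree ∧
        (∀ b : ℕ, (∑ i, ((if (p : ℤ) ∣ (f i).eval (b : ℤ) then 1 else 0) +
            (if (p : ℤ) ^ 2 ∣ (f i).eval (b : ℤ) then 1 else 0)) : ℕ) ≤ 2) ∧
        ((Finset.range (p ^ 2)).filter (fun b : ℕ =>
            (∑ i, ((if (p : ℤ) ∣ (f i).eval (b : ℤ) then 1 else 0) +
              (if (p : ℤ) ^ 2 ∣ (f i).eval (b : ℤ) then 1 else 0)) : ℕ) = 1)).card =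
          (p - 1) * Literature.NumberTheory.Sieve.polyRootCountMod f p ∧
        ((Finset.range (p ^ 2)).filter (fun b : ℕ =>
            (∑ i, ((if (p : ℤ) ∣ (f i).eval (b : ℤ) then 1 else 0) +
              (if (p : ℤ) ^ 2 ∣ (f i).eval (b : ℤ) then 1 else 0)) : ℕ) = 2)).card =
          Literature.NumberTheory.Sieve.polyRootCountMod f p) →
    ∀ (k : ℕ) (f : Fin k → Polynomial ℤ), Literature.NumberTheory.Sieve.IsBatemanHornSystem f →
      ∃ A C Y₀ : ℝ, 0 ≤ A ∧ ∀ Y : ℝ, Y₀ ≤ Y → ∀ z : ℂ,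
        ‖∏ p ∈ Nat.primesLE ⌊Y⌋₊, (∑ b ∈ Finset.range (p ^ 2),
            z ^ (∑ i, ((if (p : ℤ) ∣ (f i).eval (b : ℤ) then 1 else 0) +
              (if (p : ℤ) ^ 2 ∣ (f i).eval (b : ℤ) then 1 else 0)) : ℕ)) / (p : ℂ) ^ 2‖ ≤
          A * (Real.log Y) ^ ((k : ℝ) * (z.re - 1)) *
            Real.exp (C * ‖z - 1‖ * Real.log (‖z - 1‖ + 2)) := by
  intro hA k f hf
  classical
  obtain ⟨P₀, hP₀⟩ := hA k f hf
  obtain ⟨K, hK0, hM⟩ := stub_mertensOmega k f hf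
  set P₁ : ℕ := max P₀ 3 with hP₁
  have hP₁3 : 3 ≤ P₁ := le_max_right _ _
  set π : ℕ → ℕ → ℕ := fun p b => ∑ i, ((if (p : ℤ) ∣ (f i).eval (b : ℤ) then 1 else 0) +
    (if (p : ℤ) ^ 2 ∣ (f i).eval (b : ℤ) then 1 else 0)) with hπ
  set ω : ℕ → ℕ := fun p => polyRootCountMod f p with hω
  have hπk : ∀ p b, π p b ≤ 2 * k := by
    intro p b
    calc π p b ≤ ∑ _i : Fin k, 2 := sum_le_sum fun i _ => by split_ifs <;> omega
      _ = 2 * k := by simp [mul_comm]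
  have hgood : ∀ p : ℕ, p.Prime → P₁ < p → ω p ≤ ∑ i, (f i).natDegree ∧ ∀ z : ℂ,
      ∑ b ∈ range (p ^ 2), z ^ π p b = (p : ℂ) ^ 2 + ω p * (z - 1) * (p + z) := by
    intro p hp hp1
    obtain ⟨hωD, hle2, h1, h2⟩ := hP₀ p hp (lt_of_le_of_lt (le_max_left _ _) hp1)
    exact ⟨hωD, fun z => locE_good hp.one_le (π p) hle2 h1 h2 z⟩
  obtain ⟨A, C, hA0, -, hΛ⟩ := engine_complex π ω hP₁3 hK0 hπk hgood hM
  have hP₁' : (3 : ℝ) ≤ P₁ := by exact_mod_cast hP₁3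
  exact ⟨A, C, P₁, hA0, fun Y hY z => hΛ Y (hP₁'.trans hY) z⟩

end Summit.Parity.BatemanHorn.Cruxes.SystemZeroRepulsion.SmoothRoughLatticeAcquisition

end
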